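import Mathlib
import Summits.Ventures.PercRepro2.Defs
import Summits.Ventures.PercRepro2.Harris
import Summits.Ventures.PercRepro2.Graph
import Summits.Ventures.PercRepro2.Events
import Summits.Ventures.PercRepro2.Induced
import Summits.Ventures.PercRepro2.BHK
import Summits.Ventures.PercRepro2.BHKEvents
import Summits.Ventures.PercRepro2.BHKAvoid
import Summits.Ventures.PercRepro2.ExploreA3
import Summits.Ventures.PercRepro2.RootLeafUSigns

/-!
# The (B) and (C) sign lemmas of the first root-leaf-at-`u` coefficient
(blind cell PercRepro2, p4 g3; proofs/P4-G4U-T1.md §3, S3-CLASSES.md §S3.10 (G4-u) v27)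

Companion of `RootLeafUSigns.lean` (which holds the helpers and the (I3) theorem `I3_nonneg`).
Five vertices `o, a₂, c, b, u`; `K = C(a₂)`, `hb = P(b ∈ K)`, `d0 = P(c ∉ K)`, `e0 = P(o ∈ K, c ∉ K)`.

* **`B_nonneg`** (the (B) term): `P(Y, b ∈ K) ≤ hb·P(Y)` for `Y = {o ∈ C(u), c ∉ C(u), u ↮ a₂}`:
  explore `C(u)` avoiding `a₂`; the residual connection probability `gb(C(u))` is at most `hb`.
* **`I2_nonneg`** (the (C) term = the predecessor's (I2)):
  `d0·P(c,u ∉ K, o ∈ K, b ∈ C(u)) ≤ e0·P(c,u ∉ K, b ∈ C(u))`: explore `K` avoiding `{c, u}` with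
  the antitone residual functional `rb = P_{G∖K}(u ↔ b)`; `bhk_induced` twice — `X = Y = {c, u}`
  with `F₁ = 1_{o∈·}`, `F₂ = 1 − rb`, and the monotone-avoidance instance `X = {c, u}`, `Y = {c}`,
  `F₂ = 1`.
With `I3_nonneg` and the mass `(D) ≥ 0` these are the four signs of
`T1 = 2·[d0·(A) + d0·(B) + d0·(C) + d0·(D)]` (S3 v27 (1)).
-/

namespace Summit.Ventures.PercRepro2

namespace RootLeafU

variable {V : Type*} {E : Type*} [Fintype E] [DecidableEq E] [Fintype V] [DecidableEq V]
  {R : Type*} [Field R] [LinearOrder R] [IsStrictOrderedRing R]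

section SignsBC

variable (p : E → R) (ends : E → Sym2 V) (o a₂ c b u : V)

omit [DecidableEq V] in
/-- **The (B) term**: for `Y = {o ∈ C(u), c ∉ C(u), u ↮ a₂}`, `P(Y, b ∈ C(a₂)) ≤ P(a₂ ↔ b)·P(Y)`:
explore `C(u)` avoiding `a₂`; the residual connection probability `gb(C(u)) = P_{G∖C(u)}(a₂ ↔ b)`
is at most `P(a₂ ↔ b)` pointwise. -/
theorem B_nonneg_cl (hp : IsProbVec p) :
    prob p (clusterInEvent ends u {W | o ∈ W ∧ c ∉ W} ∩ clusterInEvent ends a₂ {W | b ∈ W} ∩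
        avoidAll ends u {a₂}) ≤
      prob p (connEvent ends a₂ b) *
        prob p (clusterInEvent ends u {W | o ∈ W ∧ c ∉ W} ∩ avoidAll ends u {a₂}) := by
  classical
  have ha2 : a₂ ∈ ({a₂} : Finset V) := by simp
  have tB := prob_clusterIn_inter_avoid_eq_expect p ends u a₂ ha2 {W | o ∈ W ∧ c ∉ W} {W | b ∈ W}
  have t1 := prob_clusterIn_inter_avoid_eq_expect p ends u a₂ ha2 {W | o ∈ W ∧ c ∉ W} Set.univ
  have hg1 : ∀ K, delClusterProb p ends a₂ Set.univ K = 1 := delClusterProb_univ p ends a₂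
  simp only [clusterInEvent_univ, Set.inter_univ, hg1, mul_one] at t1
  rw [tB, t1, ← expect_const_mul]
  refine expect_mono hp fun ω => ?_
  have h1 : delClusterProb p ends a₂ {W | b ∈ W} (cluster ends ω u) ≤ prob p (connEvent ends a₂ b) :=
    delClusterProb_mem_le p ends hp a₂ b _
  have h2 : (0 : R) ≤ ({W : Set V | o ∈ W ∧ c ∉ W}).indicator 1 (cluster ends ω u) :=
    Set.indicator_apply_nonneg fun _ => zero_le_one
  have h3 : (0 : R) ≤ (avoidAll ends u {a₂}).indicator 1 ω :=
    Set.indicator_apply_nonneg fun _ => zero_le_one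
  calc ({W : Set V | o ∈ W ∧ c ∉ W}).indicator 1 (cluster ends ω u) *
        delClusterProb p ends a₂ {W | b ∈ W} (cluster ends ω u) * (avoidAll ends u {a₂}).indicator 1 ω
      ≤ ({W : Set V | o ∈ W ∧ c ∉ W}).indicator 1 (cluster ends ω u) *
        prob p (connEvent ends a₂ b) * (avoidAll ends u {a₂}).indicator 1 ω :=
        mul_le_mul_of_nonneg_right (mul_le_mul_of_nonneg_left h1 h2) h3
    _ = prob p (connEvent ends a₂ b) * (({W : Set V | o ∈ W ∧ c ∉ W}).indicator 1 (cluster ends ω u) *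
        (avoidAll ends u {a₂}).indicator 1 ω) := by ring

omit [DecidableEq V] in
/-- **(B) in connection events**: `P(u ↔ o, u ↮ c, a₂ ↔ b, u ↮ a₂) ≤ P(a₂ ↔ b)·P(u ↔ o, u ↮ c, u ↮ a₂)`. -/
theorem B_nonneg (hp : IsProbVec p) :
    prob p (connEvent ends u o ∩ (connEvent ends u c)ᶜ ∩ connEvent ends a₂ b ∩
        (connEvent ends u a₂)ᶜ) ≤
      prob p (connEvent ends a₂ b) *
        prob p (connEvent ends u o ∩ (connEvent ends u c)ᶜ ∩ (connEvent ends u a₂)ᶜ) := by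
  have h := B_nonneg_cl p ends o a₂ c b u hp
  simpa only [ExploreA3.clusterInEvent_mem_eq, clusterInEvent_mem_notMem_eq, avoidAll_singleton_eq] using h

/-- **The (C) term = the predecessor's (I2)**: with `K = C(a₂)`, `d0 = P(c ∉ K)`,
`e0 = P(o ∈ K, c ∉ K)`: `d0·P(c, u ∉ K, o ∈ K, b ∈ C(u)) ≤ e0·P(c, u ∉ K, b ∈ C(u))`.
Explore `K` avoiding `{c, u}` with the residual functional `rb = P_{G∖K}(u ↔ b)` (antitone);
`bhk_induced` twice: `X = Y = {c, u}` with `F₁ = 1_{o∈·}`, `F₂ = 1 − rb`, and the monotone-avoidance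
instance `X = {c, u}`, `Y = {c}` with `F₂ = 1`. -/
theorem I2_nonneg_cl (hp : IsProbVec p) :
    prob p (avoidAll ends a₂ {c}) *
        prob p (clusterInEvent ends a₂ {W | o ∈ W} ∩ clusterInEvent ends u {W | b ∈ W} ∩
          avoidAll ends a₂ {c, u}) ≤
      prob p (clusterInEvent ends a₂ {W | o ∈ W} ∩ avoidAll ends a₂ {c}) *
        prob p (clusterInEvent ends u {W | b ∈ W} ∩ avoidAll ends a₂ {c, u}) := by
  classical
  have hu : u ∈ ({c, u} : Finset V) := by simp
  have hc : c ∈ ({c} : Finset V) := by simp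
  -- tower identities
  have tOB := prob_clusterIn_inter_avoid_eq_expect p ends a₂ u hu {W | o ∈ W} {W | b ∈ W}
  have tB := prob_clusterIn_inter_avoid_eq_expect p ends a₂ u hu Set.univ {W | b ∈ W}
  have tO' := prob_clusterIn_inter_avoid_eq_expect p ends a₂ u hu {W | o ∈ W} Set.univ
  have tO := prob_clusterIn_inter_avoid_eq_expect p ends a₂ c hc {W | o ∈ W} Set.univ
  have hg1 : ∀ K, delClusterProb p ends u Set.univ K = 1 := delClusterProb_univ p ends u
  have hg1' : ∀ K, delClusterProb p ends c Set.univ K = 1 := delClusterProb_univ p ends c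
  simp only [clusterInEvent_univ, Set.univ_inter, Set.inter_univ, Set.indicator_univ,
    Pi.one_apply, one_mul, hg1, hg1', mul_one] at tOB tB tO' tO
  have eN : prob p (avoidAll ends a₂ {c}) =
      expect p fun ω => (avoidAll ends a₂ {c}).indicator 1 ω := prob_eq_expect_indicator p _
  have eN' : prob p (avoidAll ends a₂ {c, u}) =
      expect p fun ω => (avoidAll ends a₂ {c, u}).indicator 1 ω := prob_eq_expect_indicator p _
  -- monotonicity
  have hrb_anti : Antitone (delClusterProb p ends u {W | b ∈ W}) :=
    delClusterProb_anti p hp ends u (ExploreA3.isUpperSet_mem b)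
  have hrb1 : ∀ K, delClusterProb p ends u {W | b ∈ W} K ≤ 1 := delClusterProb_le_one p hp ends u _
  have hχ_mono : Monotone (fun K : Set V => ({W : Set V | o ∈ W}).indicator (1 : Set V → R) K) := by
    intro K K' h
    simp only
    by_cases ho : o ∈ K
    · have ho' : o ∈ K' := h ho
      simp [Set.indicator, ho, ho']
    · simp [Set.indicator, ho]
      split_ifs <;> norm_num
  have hχ0 : ∀ K : Set V, (0 : R) ≤ ({W : Set V | o ∈ W}).indicator 1 K :=
    fun K => Set.indicator_apply_nonneg fun _ => zero_le_one
  have hF₂ : Monotone (fun K => 1 - delClusterProb p ends u {W | b ∈ W} K) :=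
    fun K K' h => by simp only; linarith [hrb_anti h]
  have hF₂0 : ∀ K, 0 ≤ 1 - delClusterProb p ends u {W | b ∈ W} K := fun K => by linarith [hrb1 K]
  have hone : Monotone (fun _ : Set V => (1 : R)) := fun _ _ _ => le_rfl
  have hone0 : ∀ _ : Set V, (0 : R) ≤ 1 := fun _ => zero_le_one
  have e : ∀ (F : Set V → R) (X : Finset V), clusterObs ends Finset.univ a₂ F *
      (avoidAll ends a₂ X).indicator 1 =
      fun ω => F (cluster ends ω a₂) * (avoidAll ends a₂ X).indicator 1 ω := by
    intro F X
    funext ω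
    simp only [Pi.mul_apply, clusterObs_apply, clusterIn_univ]
  -- (i) BHK on `K` avoiding `{c, u}`: `F₁ = 1_{o∈·}`, `F₂ = 1 − rb`
  have key1 := bhk_induced p hp ends a₂ hχ_mono hF₂ hχ0 hF₂0 Finset.univ {c, u} {c, u}
    (Finset.subset_univ _) (Finset.subset_univ _)
  simp only [Finset.inter_self, Finset.union_self, REvent_univ] at key1
  rw [e, e, e] at key1
  simp only [Pi.mul_apply] at key1
  -- (ii) the monotone-avoidance instance: `X = {c, u}`, `Y = {c}`, `F₂ = 1`
  have key2 := bhk_induced p hp ends a₂ hχ_mono hone hχ0 hone0 Finset.univ {c, u} {c}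
    (Finset.subset_univ _) (Finset.subset_univ _)
  have hXY : ({c, u} : Finset V) ∩ {c} = {c} := Finset.inter_eq_right.2 (by simp)
  have hXY' : ({c, u} : Finset V) ∪ {c} = {c, u} := Finset.union_eq_left.2 (by simp)
  rw [hXY, hXY'] at key2
  simp only [REvent_univ] at key2
  rw [e, e, e] at key2
  simp only [Pi.mul_apply, mul_one, one_mul] at key2
  -- the expectations in terms of masses
  have f1 : expect p (fun ω => ({W : Set V | o ∈ W}).indicator 1 (cluster ends ω a₂) *
      (avoidAll ends a₂ {c, u}).indicator 1 ω) =
      prob p (clusterInEvent ends a₂ {W | o ∈ W} ∩ avoidAll ends a₂ {c, u}) := tO'.symm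
  have f2 : expect p (fun ω => ({W : Set V | o ∈ W}).indicator 1 (cluster ends ω a₂) *
      (avoidAll ends a₂ {c}).indicator 1 ω) =
      prob p (clusterInEvent ends a₂ {W | o ∈ W} ∩ avoidAll ends a₂ {c}) := tO.symm
  have f3 : expect p (fun ω => (1 - delClusterProb p ends u {W | b ∈ W} (cluster ends ω a₂)) *
      (avoidAll ends a₂ {c, u}).indicator 1 ω) =
      prob p (avoidAll ends a₂ {c, u}) -
        prob p (clusterInEvent ends u {W | b ∈ W} ∩ avoidAll ends a₂ {c, u}) := by
    rw [tB, eN', ← expect_sub]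
    congr 1
    funext ω
    simp only [Pi.sub_apply]
    ring
  have f4 : expect p (fun ω => ({W : Set V | o ∈ W}).indicator 1 (cluster ends ω a₂) *
      (1 - delClusterProb p ends u {W | b ∈ W} (cluster ends ω a₂)) *
      (avoidAll ends a₂ {c, u}).indicator 1 ω) =
      prob p (clusterInEvent ends a₂ {W | o ∈ W} ∩ avoidAll ends a₂ {c, u}) -
        prob p (clusterInEvent ends a₂ {W | o ∈ W} ∩ clusterInEvent ends u {W | b ∈ W} ∩
          avoidAll ends a₂ {c, u}) := by
    rw [tO', tOB, ← expect_sub]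
    congr 1
    funext ω
    simp only [Pi.sub_apply]
    ring
  rw [f1, f3, f4] at key1
  rw [f1, f2, ← eN] at key2
  have hA0 : 0 ≤ prob p (clusterInEvent ends a₂ {W | o ∈ W} ∩ clusterInEvent ends u {W | b ∈ W} ∩
      avoidAll ends a₂ {c, u}) := prob_nonneg hp _
  have hAle : prob p (clusterInEvent ends a₂ {W | o ∈ W} ∩ clusterInEvent ends u {W | b ∈ W} ∩
      avoidAll ends a₂ {c, u}) ≤ prob p (avoidAll ends a₂ {c, u}) :=
    prob_mono hp fun ω hω => hω.2
  have hB0 : 0 ≤ prob p (clusterInEvent ends u {W | b ∈ W} ∩ avoidAll ends a₂ {c, u}) :=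
    prob_nonneg hp _
  have hd0 : 0 ≤ prob p (avoidAll ends a₂ {c}) := prob_nonneg hp _
  have he0 : 0 ≤ prob p (clusterInEvent ends a₂ {W | o ∈ W} ∩ avoidAll ends a₂ {c}) :=
    prob_nonneg hp _
  have he0' : 0 ≤ prob p (clusterInEvent ends a₂ {W | o ∈ W} ∩ avoidAll ends a₂ {c, u}) :=
    prob_nonneg hp _
  have hN'0 : 0 ≤ prob p (avoidAll ends a₂ {c, u}) := prob_nonneg hp _
  rcases hN'0.lt_or_eq with hpos | hzero
  · have h1 : prob p (avoidAll ends a₂ {c, u}) *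
        prob p (clusterInEvent ends a₂ {W | o ∈ W} ∩ clusterInEvent ends u {W | b ∈ W} ∩
          avoidAll ends a₂ {c, u}) ≤
        prob p (clusterInEvent ends a₂ {W | o ∈ W} ∩ avoidAll ends a₂ {c, u}) *
          prob p (clusterInEvent ends u {W | b ∈ W} ∩ avoidAll ends a₂ {c, u}) := by
      nlinarith [key1]
    have h3 : prob p (avoidAll ends a₂ {c, u}) * (prob p (avoidAll ends a₂ {c}) *
        prob p (clusterInEvent ends a₂ {W | o ∈ W} ∩ clusterInEvent ends u {W | b ∈ W} ∩
          avoidAll ends a₂ {c, u})) ≤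
        prob p (avoidAll ends a₂ {c, u}) *
          (prob p (clusterInEvent ends a₂ {W | o ∈ W} ∩ avoidAll ends a₂ {c}) *
            prob p (clusterInEvent ends u {W | b ∈ W} ∩ avoidAll ends a₂ {c, u})) := by
      nlinarith [h1, key2, hd0, hB0]
    exact le_of_mul_le_mul_left h3 hpos
  · have : prob p (clusterInEvent ends a₂ {W | o ∈ W} ∩ clusterInEvent ends u {W | b ∈ W} ∩
        avoidAll ends a₂ {c, u}) = 0 := le_antisymm (hAle.trans hzero.symm.le) hA0
    rw [this, mul_zero]
    exact mul_nonneg he0 hB0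

/-- **(C) = (I2) in connection events**: with `d0 = P(a₂ ↮ c)`, `e0 = P(a₂ ↔ o, a₂ ↮ c)`,
`d0·P(a₂ ↔ o, u ↔ b, a₂ ↮ c, a₂ ↮ u) ≤ e0·P(u ↔ b, a₂ ↮ c, a₂ ↮ u)`. -/
theorem I2_nonneg (hp : IsProbVec p) :
    prob p (connEvent ends a₂ c)ᶜ *
        prob p (connEvent ends a₂ o ∩ connEvent ends u b ∩ avoidAll ends a₂ {c, u}) ≤
      prob p (connEvent ends a₂ o ∩ (connEvent ends a₂ c)ᶜ) *
        prob p (connEvent ends u b ∩ avoidAll ends a₂ {c, u}) := by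
  have h := I2_nonneg_cl p ends o a₂ c b u hp
  simpa only [ExploreA3.clusterInEvent_mem_eq, avoidAll_singleton_eq] using h

end SignsBC

end RootLeafU

end Summit.Ventures.PercRepro2
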